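import Literature.MathematicalPhysics.QuantumFieldTheory.Balaban1983to89.B4Eq222SupDecay

/-!
# `Balaban1983to89.B4Eq222SupDecayObs` — [Balaban1983RegularityDecay] (2.12)–(2.13) ⇒ (2.22) p. 579 IN THE SUP NORM FOR AN OBSERVABLE
# `T∘G_k(Ω,A)` OF THE GREEN'S FUNCTION (the shape of the DERIVATIVE MEMBER «|(D^η_{A,μ}G_k(Ω,A)f)(x)| ≤ c₀exp(−δ₀dist(x, supp f))‖f‖_∞»
# of Theorem (1.10)): abstract weighted form, companion of `B4Eq222SupDecay` (the case `T = 1`)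

statement-level skeleton of published theorems with citation tags; proofs where landed; nothing here is a claim about the Yang–Mills mass gap

CITATION HEADER (lean-in-tree rule).  T. Bałaban, *Regularity and decay of lattice Green's functions*, Commun. Math. Phys. **89** (1983)
571–597, doi:10.1007/bf01214744 [Balaban1983RegularityDecay] (cell paper B4; held text `paper:balaban1983-cmp89-regularity-decay`, journal
page = PDF page + 570; pp. 573, 577–579 read by this seat).  Cell `lit-balaban` (HOME `run/shared/lean/pub/lit-balaban/`), Phase-2 proof
seat **p35** gen 9 (unit `lit-balaban-p35`); SKELETON rows **B4.Eq2.12**, **B4.Eq2.13**, **B4.Eq2.22**, **B4.Thm@573** ((1.10) BOTH members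
with the decay factor, abstract operator form) and — the consumer — **B1.Prop2.1**/(2.25) derivative clause at a regular background `A ≠ 0` on
`Ω = T_ε`.  USED BY NAME: gen 8's `B4Eq212SupNeumann.parametrix_identity`, this seat's `B4Eq222SupDecay.{norm_sum_le_of_rows,
smul_weight_localize, norm_localize_le, norm_weighted_remainder_le}`; nothing restated.

WHAT IS PRINTED (p. 573, p. 579).  p. 573, Theorem: *«Similarly |(D^η_{A,μ}G_k(Ω,A)f)(x)|, |(G_k(Ω,A)f)(x)| ≤ c₀exp(−δ₀dist(x, supp f))‖f‖_∞
(1.10)»*; p. 578: *«These two lemmas together with the representation (2.13) imply the theorem»* — Lemma 2.2 (2.17) supplies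
`‖D^η_{A,μ}G_k(□,A)f‖_q` as well as `‖G_k(□,A)f‖_q`; p. 579: *«… ≤ 2^{d+1}c₁ … exp(−M⁻¹dist({x, x′}, supp f))‖f‖_∞ (2.22) … Thus the
inequality (1.9) is proved, similarly the inequalities (1.10).»*  In the walk (2.13) only the FIRST letter `h_{ω₀}G_k(□_{ω₀},Ã_{ω₀})h_{ω₀}`
carries the derivative; every later letter is the same `K_ωG_k(□_ω,Ã_ω)h_ω` as for the value member.

WHAT THIS FILE PROVES (theorems only, kernel-checked; no `def`, no `sorry`; axioms standard).  Setting of `B4Eq222SupDecay` plus an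
OBSERVABLE: a linear map `T : (X → E) → (B → E′)` into fields on a second finite index set `B` (bonds), read at sites through `π : B → X`,
LOCAL in the sense `T(h_jF)(b) = 0` unless `π(b) ∈ S_j`, with the per-cube input `‖T(h_jG_j(h_jψ))‖ ≤ γ_T‖ψ‖` (for `T = D^η_A`: Leibniz +
Lemma 2.2 (2.17) derivative member + `|∂h_j| ≤ O(M⁻¹)`).
* §1 `norm_weighted_obs_parametrix_le` — `‖e^{−w∘π}T(G₀e^{w}ψ)‖ ≤ m₀γ_Te^Λ‖ψ‖` (the first letter of the walk, observed).
* §2 **`norm_obs_conj_apply_le`** — if `m₀βe^Λ ≤ ½` then `‖e^{−w∘π}T(G(e^{w}ψ))‖_∞ ≤ 2m₀γ_Te^Λ‖ψ‖_∞` (`TG = TG₀ − TG·R′`, the remainder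
  in the weighted norm `≤ ½` by `B4Eq222SupDecay.norm_weighted_remainder_le`; no input on `G_j` alone is needed).
* §3 **`norm_obs_apply_le_of_weight`**, **`norm_obs_apply_le_of_dist`** / `norm_obs_inverse_apply_le_of_dist` — THE PRINTED SHAPE of the
  derivative member: `‖(TGg)(b)‖ ≤ 2m₀γ_Te^{δ·diam}·e^{−δD}·M` for `‖g‖ ≤ M` vanishing on `{y : dist(π b, y) < D}`, every `δ ≥ 0` with
  `m₀βe^{δ·diam} ≤ ½`.  With `B = X`, `π = id`, `T = 1` these are `B4Eq222SupDecay`'s theorems.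
DECLARED DEVIATION: as in `B4Eq222SupDecay` — the Neumann series (2.12) is summed in the exponentially weighted sup norm (Combes–Thomas form
of the walk count of p. 579); inputs and output shape as printed.  HONEST SCOPE: abstract; the per-cube input for `T`, the locality of `T`
and all hypotheses of `B4Eq222SupDecay` are HYPOTHESES here (discharged on the torus for `T = D^ε_A` by this seat's torus files); `E`
finite-dimensional from §2 on.  Unit `lit-balaban-p35` gen 9 (literature-prover-lit-balaban-p35-g9-0).
-/

open scoped BigOperators

namespace Literature.MathematicalPhysics.QuantumFieldTheory.Balaban1983to89.B4Eq222SupDecayObs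

open Literature.MathematicalPhysics.QuantumFieldTheory.Balaban1983to89.B4Eq212SupNeumann (parametrix_identity)
open Literature.MathematicalPhysics.QuantumFieldTheory.Balaban1983to89.B4Eq222SupDecay
  (norm_sum_le_of_rows smul_weight_localize norm_localize_le norm_weighted_remainder_le)

variable {X : Type*} [Fintype X] [DecidableEq X] {E : Type*} [NormedAddCommGroup E] [NormedSpace ℝ E]
variable {J : Type*} [Fintype J]
variable {B : Type*} [Fintype B] {E' : Type*} [NormedAddCommGroup E'] [NormedSpace ℝ E']

/-! ## §1 The observed first letter: `‖e^{−w∘π}T(G₀e^{w}ψ)‖ ≤ m₀γ_Te^Λ‖ψ‖` -/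

/-- **`‖e^{−w(π·)}T(G₀(e^{w}ψ))‖_∞ ≤ m₀γ_Te^Λ‖ψ‖_∞`** for `G₀ = Σ_j h_jG_jh_j` (2.2) and a local observable `T` (`T(h_jF)(b) ≠ 0 ⇒ π(b) ∈ S_j`):
at a bond `b` only the `≤ m₀` cubes with `π(b) ∈ S_j` contribute, and for those `e^{−w(π b)}T(h_jG_j(h_je^{w}ψ))(b) = T(h_jG_j(h_jψ_{j,π b}))(b)`
with `‖T(h_jG_j(h_jψ_{j,π b}))‖ ≤ γ_Te^Λ‖ψ‖`. [cite: Balaban1983RegularityDecay, (2.13) p.577; (2.22) p.579; Theorem (1.10) p.573] -/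
theorem norm_weighted_obs_parametrix_le (Gj : J → Module.End ℝ (X → E)) (h : J → X → ℝ)
    (S : J → Finset X) (hhS : ∀ j x, h j x ≠ 0 → x ∈ S j)
    (m₀ : ℕ) (hmult : ∀ x, (Finset.univ.filter fun j => x ∈ S j).card ≤ m₀)
    (T : (X → E) →ₗ[ℝ] (B → E')) (π : B → X) (hT0 : ∀ j (F : X → E) b, π b ∉ S j → T (h j • F) b = 0)
    {γT : ℝ} (hγT : 0 ≤ γT) (hTj : ∀ j (ψ : X → E), ‖T (h j • Gj j (h j • ψ))‖ ≤ γT * ‖ψ‖)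
    (w : X → ℝ) {Λ : ℝ} (hw : ∀ j, ∀ y ∈ S j, ∀ y' ∈ S j, w y - w y' ≤ Λ) (ψ : X → E) :
    ‖(fun b => Real.exp (-w (π b)) • T (∑ j, h j • Gj j (h j • fun y => Real.exp (w y) • ψ y)) b : B → E')‖
      ≤ m₀ * (γT * Real.exp Λ * ‖ψ‖) := by
  classical
  have hfun : (fun b => Real.exp (-w (π b)) • T (∑ j, h j • Gj j (h j • fun y => Real.exp (w y) • ψ y)) b : B → E')
      = ∑ j, (fun b => Real.exp (-w (π b)) • T (h j • Gj j (h j • fun y => Real.exp (w y) • ψ y)) b) := by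
    funext b
    rw [map_sum, Finset.sum_apply, Finset.sum_apply, Finset.smul_sum]
  rw [hfun]
  have hmultB : ∀ b : B, (Finset.univ.filter fun j => b ∈ Finset.univ.filter fun b' : B => π b' ∈ S j).card ≤ m₀ := by
    intro b
    have e : (Finset.univ.filter fun j => b ∈ Finset.univ.filter fun b' : B => π b' ∈ S j)
        = Finset.univ.filter fun j => π b ∈ S j := by
      ext j; simp
    rw [e]; exact hmult (π b)
  refine norm_sum_le_of_rows (fun j => Finset.univ.filter fun b' : B => π b' ∈ S j) m₀ hmultB _ (by positivity)
    (fun j b hb => ?_) (fun j b hb => ?_)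
  · have hπ : π b ∉ S j := fun hh => hb (by rw [Finset.mem_filter]; exact ⟨Finset.mem_univ _, hh⟩)
    rw [hT0 j _ b hπ, smul_zero]
  · have hπ : π b ∈ S j := by rw [Finset.mem_filter] at hb; exact hb.2
    have hloc := smul_weight_localize (E := E) h S hhS w j (π b) ψ
    have hψloc := norm_localize_le S w hw hπ ψ
    set ψloc : X → E := fun y => if y ∈ S j then Real.exp (w y - w (π b)) • ψ y else 0 with hψloc_def
    have hval : Real.exp (-w (π b)) • T (h j • Gj j (h j • fun y => Real.exp (w y) • ψ y)) b
        = T (h j • Gj j (h j • ψloc)) b := by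
      rw [hloc, map_smul (Gj j) (Real.exp (w (π b))), ← smul_comm (Real.exp (w (π b))) (h j),
        map_smul T (Real.exp (w (π b))), Pi.smul_apply, smul_smul, ← Real.exp_add, neg_add_cancel, Real.exp_zero, one_smul]
    rw [hval]
    calc ‖T (h j • Gj j (h j • ψloc)) b‖ ≤ γT * ‖ψloc‖ := (norm_le_pi_norm _ b).trans (hTj j ψloc)
      _ ≤ γT * (Real.exp Λ * ‖ψ‖) := mul_le_mul_of_nonneg_left hψloc hγT
      _ = γT * Real.exp Λ * ‖ψ‖ := by ring

/-! ## §2 `‖e^{−w∘π}·T·G_k(Ω,A)·e^{w}‖_{∞→∞} ≤ 2m₀γ_Te^Λ` -/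

omit [Fintype X] [DecidableEq X] in
/-- `e^{w}·(e^{−w}·v) = v` pointwise. [folklore] -/
private theorem weight_unweight (w : X → ℝ) (v : X → E) :
    (fun y => Real.exp (w y) • (Real.exp (-w y) • v y)) = v := by
  funext y
  rw [smul_smul, ← Real.exp_add, add_neg_cancel, Real.exp_zero, one_smul]

/-- **(2.12) FOR THE OBSERVABLE, CONJUGATED BY `e^{w}`: `‖e^{−w(π·)}T(G(e^{w}ψ))‖_∞ ≤ 2m₀γ_Te^Λ‖ψ‖_∞` whenever `m₀βe^Λ ≤ ½`.**  From
(2.9)–(2.11) and `GH = 1`: `TG = TG₀ − TG·(Σ_jK_jG_jh_j)`; conjugating, `(TG)_w = (TG₀)_w − (TG)_w·R′_w` with `‖(TG₀)_w‖ ≤ m₀γ_Te^Λ` (§1) and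
`‖R′_w‖ ≤ m₀βe^Λ ≤ ½` (`B4Eq222SupDecay.norm_weighted_remainder_le`), so the finite operator norm obeys `‖(TG)_w‖ ≤ m₀γ_Te^Λ + ½‖(TG)_w‖`.
[cite: Balaban1983RegularityDecay, (2.12)–(2.13) p.577; (2.22) p.579; Theorem (1.10) p.573] -/
theorem norm_obs_conj_apply_le [FiniteDimensional ℝ E] (H G : Module.End ℝ (X → E)) (hGH : G * H = 1)
    (Hj Gj : J → Module.End ℝ (X → E)) (hHG : ∀ j, Hj j * Gj j = 1)
    (h : J → X → ℝ) (hsum : ∀ x, ∑ j, h j x ^ 2 = 1)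
    (hagree : ∀ j (ψ : X → E), H (h j • ψ) = Hj j (h j • ψ))
    (S : J → Finset X) (hhS : ∀ j x, h j x ≠ 0 → x ∈ S j)
    (hKS : ∀ j (θ : X → E) x, x ∉ S j → (Hj j (h j • θ) - h j • Hj j θ) x = 0)
    (m₀ : ℕ) (hmult : ∀ x, (Finset.univ.filter fun j => x ∈ S j).card ≤ m₀)
    {β : ℝ} (hβ : 0 ≤ β)
    (hKj : ∀ j (ψ : X → E), ‖Hj j (h j • Gj j (h j • ψ)) - h j • Hj j (Gj j (h j • ψ))‖ ≤ β * ‖ψ‖)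
    (T : (X → E) →ₗ[ℝ] (B → E')) (π : B → X) (hT0 : ∀ j (F : X → E) b, π b ∉ S j → T (h j • F) b = 0)
    {γT : ℝ} (hγT : 0 ≤ γT) (hTj : ∀ j (ψ : X → E), ‖T (h j • Gj j (h j • ψ))‖ ≤ γT * ‖ψ‖)
    (w : X → ℝ) {Λ : ℝ} (hw : ∀ j, ∀ y ∈ S j, ∀ y' ∈ S j, w y - w y' ≤ Λ)
    (hsmall : (m₀ : ℝ) * β * Real.exp Λ ≤ 1 / 2) (ψ : X → E) :
    ‖(fun b => Real.exp (-w (π b)) • T (G (fun y => Real.exp (w y) • ψ y)) b : B → E')‖ ≤ 2 * m₀ * (γT * Real.exp Λ) * ‖ψ‖ := by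
  -- the conjugated observable `(TG)_w = e^{−w∘π}·T·G·e^{w}` as a continuous linear map
  let Ew : (X → E) →ₗ[ℝ] (X → E) := LinearMap.pi fun x => Real.exp (w x) • (LinearMap.proj x : (X → E) →ₗ[ℝ] E)
  let EwB : (B → E') →ₗ[ℝ] (B → E') :=
    LinearMap.pi fun b => Real.exp (-w (π b)) • (LinearMap.proj b : (B → E') →ₗ[ℝ] E')
  set TGw : (X → E) →L[ℝ] (B → E') := LinearMap.toContinuousLinearMap (EwB.comp (T.comp (G.comp Ew))) with hTGw_def
  have hTGw : ∀ φ : X → E, (fun b => Real.exp (-w (π b)) • T (G (fun y => Real.exp (w y) • φ y)) b : B → E') = TGw φ :=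
    fun φ => rfl
  have key : ∀ φ : X → E, ‖TGw φ‖ ≤ m₀ * (γT * Real.exp Λ * ‖φ‖) + ‖TGw‖ * (m₀ * (β * Real.exp Λ * ‖φ‖)) := by
    intro φ
    have eφ := (hTGw φ).symm
    have hP := norm_weighted_obs_parametrix_le Gj h S hhS m₀ hmult T π hT0 hγT hTj w hw φ
    have hR := norm_weighted_remainder_le Hj Gj h S hhS hKS m₀ hmult hβ hKj w hw φ
    have hpar := parametrix_identity H Hj Gj hHG h hsum hagree (fun y => Real.exp (w y) • φ y)
    set Φ : X → E := fun y => Real.exp (w y) • φ y with hΦ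
    have hG0 : G (H (∑ j, h j • Gj j (h j • Φ))) = ∑ j, h j • Gj j (h j • Φ) := by
      rw [← Module.End.mul_apply, hGH, Module.End.one_apply]
    rw [hpar, map_add] at hG0
    have hGΦ : G Φ = (∑ j, h j • Gj j (h j • Φ))
        - G (∑ j, (Hj j (h j • Gj j (h j • Φ)) - h j • Hj j (Gj j (h j • Φ)))) := by
      rw [← hG0]; abel
    set ρ : X → E := fun x => Real.exp (-w x) • (∑ j, (Hj j (h j • Gj j (h j • Φ)) - h j • Hj j (Gj j (h j • Φ)))) x
      with hρ
    have hρw : (fun y => Real.exp (w y) • ρ y) = ∑ j, (Hj j (h j • Gj j (h j • Φ)) - h j • Hj j (Gj j (h j • Φ))) := by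
      rw [hρ]; exact weight_unweight w _
    have eρ := (hTGw ρ).symm
    rw [hρw] at eρ
    have hsplit : TGw φ = (fun b => Real.exp (-w (π b)) • T (∑ j, h j • Gj j (h j • Φ)) b) - TGw ρ := by
      rw [eφ, eρ]
      funext b
      simp only [Pi.sub_apply]
      rw [hGΦ, map_sub, Pi.sub_apply, smul_sub]
    rw [hsplit]
    refine (norm_sub_le _ _).trans (add_le_add hP ?_)
    exact (TGw.le_opNorm _).trans (mul_le_mul_of_nonneg_left hR (norm_nonneg _))
  have hop : ‖TGw‖ ≤ m₀ * (γT * Real.exp Λ) + ‖TGw‖ * (m₀ * (β * Real.exp Λ)) := by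
    refine ContinuousLinearMap.opNorm_le_bound TGw (by positivity) fun φ => ?_
    calc ‖TGw φ‖ ≤ m₀ * (γT * Real.exp Λ * ‖φ‖) + ‖TGw‖ * (m₀ * (β * Real.exp Λ * ‖φ‖)) := key φ
      _ = (m₀ * (γT * Real.exp Λ) + ‖TGw‖ * (m₀ * (β * Real.exp Λ))) * ‖φ‖ := by ring
  have hhalf : ‖TGw‖ * (m₀ * (β * Real.exp Λ)) ≤ ‖TGw‖ * (1 / 2) :=
    mul_le_mul_of_nonneg_left (by rw [← mul_assoc]; exact hsmall) (norm_nonneg _)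
  have hM : ‖TGw‖ ≤ 2 * m₀ * (γT * Real.exp Λ) := by linarith
  calc ‖(fun b => Real.exp (-w (π b)) • T (G (fun y => Real.exp (w y) • ψ y)) b : B → E')‖ = ‖TGw ψ‖ := by rw [hTGw]
    _ ≤ ‖TGw‖ * ‖ψ‖ := TGw.le_opNorm ψ
    _ ≤ 2 * m₀ * (γT * Real.exp Λ) * ‖ψ‖ := mul_le_mul_of_nonneg_right hM (norm_nonneg _)

/-! ## §3 The decay of the observed Green's function: `‖(TGg)(b)‖ ≤ c₀e^{−δ·dist(π b, supp g)}‖g‖_∞` -/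

/-- **WEIGHTED POINT BOUND FOR THE OBSERVABLE**: `‖(TGg)(b)‖ ≤ 2m₀γ_Te^Λ·e^{w(π b)}·B` whenever `e^{−w(y)}‖g(y)‖ ≤ B` for all `y`.
[cite: Balaban1983RegularityDecay, (2.22) p.579; Theorem (1.10) p.573] -/
theorem norm_obs_apply_le_of_weight [FiniteDimensional ℝ E] (H G : Module.End ℝ (X → E)) (hGH : G * H = 1)
    (Hj Gj : J → Module.End ℝ (X → E)) (hHG : ∀ j, Hj j * Gj j = 1)
    (h : J → X → ℝ) (hsum : ∀ x, ∑ j, h j x ^ 2 = 1)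
    (hagree : ∀ j (ψ : X → E), H (h j • ψ) = Hj j (h j • ψ))
    (S : J → Finset X) (hhS : ∀ j x, h j x ≠ 0 → x ∈ S j)
    (hKS : ∀ j (θ : X → E) x, x ∉ S j → (Hj j (h j • θ) - h j • Hj j θ) x = 0)
    (m₀ : ℕ) (hmult : ∀ x, (Finset.univ.filter fun j => x ∈ S j).card ≤ m₀)
    {β : ℝ} (hβ : 0 ≤ β)
    (hKj : ∀ j (ψ : X → E), ‖Hj j (h j • Gj j (h j • ψ)) - h j • Hj j (Gj j (h j • ψ))‖ ≤ β * ‖ψ‖)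
    (T : (X → E) →ₗ[ℝ] (B → E')) (π : B → X) (hT0 : ∀ j (F : X → E) b, π b ∉ S j → T (h j • F) b = 0)
    {γT : ℝ} (hγT : 0 ≤ γT) (hTj : ∀ j (ψ : X → E), ‖T (h j • Gj j (h j • ψ))‖ ≤ γT * ‖ψ‖)
    (w : X → ℝ) {Λ : ℝ} (hw : ∀ j, ∀ y ∈ S j, ∀ y' ∈ S j, w y - w y' ≤ Λ)
    (hsmall : (m₀ : ℝ) * β * Real.exp Λ ≤ 1 / 2)
    (g : X → E) {Bd : ℝ} (hB0 : 0 ≤ Bd) (hB : ∀ y, Real.exp (-w y) * ‖g y‖ ≤ Bd) (b : B) :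
    ‖T (G g) b‖ ≤ 2 * m₀ * (γT * Real.exp Λ) * (Real.exp (w (π b)) * Bd) := by
  have hψB : ‖(fun y => Real.exp (-w y) • g y : X → E)‖ ≤ Bd := by
    refine (pi_norm_le_iff_of_nonneg hB0).2 fun y => ?_
    rw [norm_smul, Real.norm_eq_abs, abs_of_pos (Real.exp_pos _)]
    exact hB y
  set ψ : X → E := fun y => Real.exp (-w y) • g y with hψ
  have hg : (fun y => Real.exp (w y) • ψ y) = g := by
    rw [hψ]; exact weight_unweight w g
  have h1 := norm_obs_conj_apply_le H G hGH Hj Gj hHG h hsum hagree S hhS hKS m₀ hmult hβ hKj T π hT0 hγT hTj w hw hsmall ψ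
  rw [hg] at h1
  have h2 : ‖Real.exp (-w (π b)) • T (G g) b‖ ≤ 2 * m₀ * (γT * Real.exp Λ) * Bd :=
    ((norm_le_pi_norm (fun b => Real.exp (-w (π b)) • T (G g) b : B → E') b).trans h1).trans
      (mul_le_mul_of_nonneg_left hψB (by positivity))
  rw [norm_smul, Real.norm_eq_abs, abs_of_pos (Real.exp_pos _)] at h2
  have h3 : ‖T (G g) b‖ = Real.exp (w (π b)) * (Real.exp (-w (π b)) * ‖T (G g) b‖) := by
    rw [← mul_assoc, ← Real.exp_add, add_neg_cancel, Real.exp_zero, one_mul]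
  rw [h3]
  calc Real.exp (w (π b)) * (Real.exp (-w (π b)) * ‖T (G g) b‖) ≤ Real.exp (w (π b)) * (2 * m₀ * (γT * Real.exp Λ) * Bd) :=
        mul_le_mul_of_nonneg_left h2 (Real.exp_pos _).le
    _ = 2 * m₀ * (γT * Real.exp Λ) * (Real.exp (w (π b)) * Bd) := by ring

omit [Fintype X] [DecidableEq X] [Fintype J] in
/-- The truncated distance weight `w = δ·min(dist(x, ·), D)` has oscillation `≤ δ·diam` on a set of `dist`-diameter `≤ diam`. [folklore] -/
private theorem weight_osc_le (dist : X → X → ℝ) (hdnn : ∀ x y, 0 ≤ dist x y) (htri : ∀ x y z, dist x z ≤ dist x y + dist y z)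
    (S : J → Finset X) {diam : ℝ} (hdiam : ∀ j, ∀ y ∈ S j, ∀ y' ∈ S j, dist y y' ≤ diam) {δ : ℝ} (hδ : 0 ≤ δ) (x : X) (D : ℝ)
    (j : J) (y : X) (hy : y ∈ S j) (y' : X) (hy' : y' ∈ S j) :
    δ * min (dist x y) D - δ * min (dist x y') D ≤ δ * diam := by
  rw [← mul_sub]
  refine mul_le_mul_of_nonneg_left ?_ hδ
  have h1 : min (dist x y) D ≤ min (dist x y') D + dist y' y := by
    calc min (dist x y) D ≤ min (dist x y' + dist y' y) D := min_le_min_right D (htri x y' y)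
      _ ≤ min (dist x y' + dist y' y) (D + dist y' y) := min_le_min_left _ (le_add_of_nonneg_right (hdnn y' y))
      _ = min (dist x y') D + dist y' y := min_add_add_right _ _ _
  linarith [hdiam j y' hy' y hy]

/-- **THEOREM (1.10), DERIVATIVE-TYPE MEMBER WITH ITS DECAY FACTOR — ABSTRACT (2.22) IN THE SUP NORM FOR AN OBSERVABLE `T∘G`.**  With a
pseudo-distance `dist` (zero on the diagonal, non-negative, triangle inequality), `dist ≤ diam` on every `S_j`, `δ ≥ 0` with
`m₀βe^{δ·diam} ≤ ½`: for every `g` with `‖g‖_∞ ≤ M` vanishing on `{y : dist(π b, y) < D}` (`D ≥ 0`),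
`‖(TG g)(b)‖ ≤ 2m₀γ_Te^{δ·diam}·e^{−δD}·M` — «|(D^η_{A,μ}G_k(Ω,A)f)(x)| ≤ c₀exp(−δ₀dist(x, supp f))‖f‖_∞» for `T = D^η_A`, `π(b) = b₋`.
[cite: Balaban1983RegularityDecay, Theorem (1.10) p.573; (2.22) p.579; (2.12)–(2.13) p.577] -/
theorem norm_obs_apply_le_of_dist [FiniteDimensional ℝ E] (H G : Module.End ℝ (X → E)) (hGH : G * H = 1)
    (Hj Gj : J → Module.End ℝ (X → E)) (hHG : ∀ j, Hj j * Gj j = 1)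
    (h : J → X → ℝ) (hsum : ∀ x, ∑ j, h j x ^ 2 = 1)
    (hagree : ∀ j (ψ : X → E), H (h j • ψ) = Hj j (h j • ψ))
    (S : J → Finset X) (hhS : ∀ j x, h j x ≠ 0 → x ∈ S j)
    (hKS : ∀ j (θ : X → E) x, x ∉ S j → (Hj j (h j • θ) - h j • Hj j θ) x = 0)
    (m₀ : ℕ) (hmult : ∀ x, (Finset.univ.filter fun j => x ∈ S j).card ≤ m₀)
    {β : ℝ} (hβ : 0 ≤ β)
    (hKj : ∀ j (ψ : X → E), ‖Hj j (h j • Gj j (h j • ψ)) - h j • Hj j (Gj j (h j • ψ))‖ ≤ β * ‖ψ‖)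
    (T : (X → E) →ₗ[ℝ] (B → E')) (π : B → X) (hT0 : ∀ j (F : X → E) b, π b ∉ S j → T (h j • F) b = 0)
    {γT : ℝ} (hγT : 0 ≤ γT) (hTj : ∀ j (ψ : X → E), ‖T (h j • Gj j (h j • ψ))‖ ≤ γT * ‖ψ‖)
    (dist : X → X → ℝ) (hd0 : ∀ x, dist x x = 0) (hdnn : ∀ x y, 0 ≤ dist x y) (htri : ∀ x y z, dist x z ≤ dist x y + dist y z)
    {diam : ℝ} (hdiam : ∀ j, ∀ y ∈ S j, ∀ y' ∈ S j, dist y y' ≤ diam)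
    {δ : ℝ} (hδ : 0 ≤ δ) (hsmall : (m₀ : ℝ) * β * Real.exp (δ * diam) ≤ 1 / 2)
    (g : X → E) {M : ℝ} (hgM : ∀ y, ‖g y‖ ≤ M) {D : ℝ} (hD0 : 0 ≤ D) (b : B) (hD : ∀ y, g y ≠ 0 → D ≤ dist (π b) y) :
    ‖T (G g) b‖ ≤ 2 * m₀ * (γT * Real.exp (δ * diam)) * Real.exp (-(δ * D)) * M := by
  have hM0 : 0 ≤ M := (norm_nonneg _).trans (hgM (π b))
  set w : X → ℝ := fun y => δ * min (dist (π b) y) D with hw_def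
  have hwx : w (π b) = 0 := by
    simp only [hw_def, hd0, min_eq_left hD0, mul_zero]
  have hB : ∀ y, Real.exp (-w y) * ‖g y‖ ≤ Real.exp (-(δ * D)) * M := by
    intro y
    by_cases hy : g y = 0
    · rw [hy, norm_zero, mul_zero]; exact mul_nonneg (Real.exp_pos _).le hM0
    · have hwy : w y = δ * D := by
        simp only [hw_def, min_eq_right (hD y hy)]
      rw [hwy]
      exact mul_le_mul_of_nonneg_left (hgM y) (Real.exp_pos _).le
  have hh := norm_obs_apply_le_of_weight H G hGH Hj Gj hHG h hsum hagree S hhS hKS m₀ hmult hβ hKj T π hT0 hγT hTj w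
    (fun j y hy y' hy' => weight_osc_le dist hdnn htri S hdiam hδ (π b) D j y hy y' hy') hsmall g
    (mul_nonneg (Real.exp_pos _).le hM0) hB b
  rw [hwx, Real.exp_zero, one_mul] at hh
  linarith

/-- **The same for `G = H⁻¹` given as `Ring.inverse H`** (the shape of `HiggsCovariance.propagatorK`).
[cite: Balaban1983RegularityDecay, Theorem (1.10) p.573; (2.22) p.579] -/
theorem norm_obs_inverse_apply_le_of_dist [FiniteDimensional ℝ E] (H : Module.End ℝ (X → E)) (hH : IsUnit H)
    (Hj Gj : J → Module.End ℝ (X → E)) (hHG : ∀ j, Hj j * Gj j = 1)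
    (h : J → X → ℝ) (hsum : ∀ x, ∑ j, h j x ^ 2 = 1)
    (hagree : ∀ j (ψ : X → E), H (h j • ψ) = Hj j (h j • ψ))
    (S : J → Finset X) (hhS : ∀ j x, h j x ≠ 0 → x ∈ S j)
    (hKS : ∀ j (θ : X → E) x, x ∉ S j → (Hj j (h j • θ) - h j • Hj j θ) x = 0)
    (m₀ : ℕ) (hmult : ∀ x, (Finset.univ.filter fun j => x ∈ S j).card ≤ m₀)
    {β : ℝ} (hβ : 0 ≤ β)
    (hKj : ∀ j (ψ : X → E), ‖Hj j (h j • Gj j (h j • ψ)) - h j • Hj j (Gj j (h j • ψ))‖ ≤ β * ‖ψ‖)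
    (T : (X → E) →ₗ[ℝ] (B → E')) (π : B → X) (hT0 : ∀ j (F : X → E) b, π b ∉ S j → T (h j • F) b = 0)
    {γT : ℝ} (hγT : 0 ≤ γT)
    (hTj : ∀ j (ψ : X → E), ‖T (h j • Gj j (h j • ψ))‖ ≤ γT * ‖ψ‖)
    (dist : X → X → ℝ) (hd0 : ∀ x, dist x x = 0) (hdnn : ∀ x y, 0 ≤ dist x y) (htri : ∀ x y z, dist x z ≤ dist x y + dist y z)
    {diam : ℝ} (hdiam : ∀ j, ∀ y ∈ S j, ∀ y' ∈ S j, dist y y' ≤ diam)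
    {δ : ℝ} (hδ : 0 ≤ δ) (hsmall : (m₀ : ℝ) * β * Real.exp (δ * diam) ≤ 1 / 2)
    (g : X → E) {M : ℝ} (hgM : ∀ y, ‖g y‖ ≤ M) {D : ℝ} (hD0 : 0 ≤ D) (b : B) (hD : ∀ y, g y ≠ 0 → D ≤ dist (π b) y) :
    ‖T (Ring.inverse H g) b‖ ≤ 2 * m₀ * (γT * Real.exp (δ * diam)) * Real.exp (-(δ * D)) * M :=
  norm_obs_apply_le_of_dist H (Ring.inverse H) (Ring.inverse_mul_cancel H hH) Hj Gj hHG h hsum hagree S hhS hKS m₀ hmult hβ hKj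
    T π hT0 hγT hTj dist hd0 hdnn htri hdiam hδ hsmall g hgM hD0 b hD

end Literature.MathematicalPhysics.QuantumFieldTheory.Balaban1983to89.B4Eq222SupDecayObs
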